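import Summits.FinalStateConjecture.FinalStateConjecture.Theorems.StarvedNecksHonestFixedRadiusSettlingSurgeryLine
import Summits.FinalStateConjecture.FinalStateConjecture.Theorems.StarvedNecksHonestFixedRadiusSettlingSurgeryLineGrowing

/-!
# Negative side of crux `StarvedNecks.HonestFixedRadiusSettling` (stmt-FinalStateConjecture-13550):
# kill shapes of the two open cores of line `far-field-surgery` — POISONED FAR FAMILIES

Disprover file (cdisprove generation 4, 2026-08-16) for the registered open stubs of the picked line
`far-field-surgery` (lead c1, skeleton `4a983fe8fc73`): `stub_stableUnfoldingOneAtlas` (D′, the core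
of the SHRINKING-mass reduction `FarFieldSurgery.honestFixedRadiusSettling_of_surgery`, p117120 — its
second hypothesis) and `stub_stableUnfoldingGrowing` (D″, the core of the GROWING-mass reduction
`FarFieldSurgery.honestFixedRadiusSettling_of_farAnnulusGluing`, p121008 — its second hypothesis, whose
far-gluing partner is SwallowTheDatum's `FarAnnulusGluing`, stmt-15427).  The two stub statements occur
below VERBATIM (negated conclusions of §1 and §2, hypothesis of `cure_of_stableUnfoldingGrowing`); no
proposition is named and nothing positive about the crux is asserted.

* §1 THE KILL SHAPE OF D″ (`stableUnfoldingGrowing_false_of_poison`): D″ is false as soon as ONE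
  admissible datum carries ONE far-gluing family in the growing schedule that is POISONED
  — whatever admissible interiors are patched in below any radius
  `R₀ < R⋆`, exceptional radii (members outside `Negative.coreSet`) are unbounded.  Equivalently
  (`cure_of_stableUnfoldingGrowing`) D″ asserts that EVERY growing far-gluing family of EVERY admissible
  datum is CURED beyond some radius by ONE fixed compactly supported admissible re-filling of the
  interior.  The far annulus `{R < ‖x‖ < 32R}` of such a family is unconstrained admissible vacuum data
  of mass `≥ ηR − M_ADM(d)` (NO smallness at scale `R`: the schedule only asks `m R ≥ ηR` and exactness
  beyond `32R`), an adversarial strong-field playground which the interior probe never touches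
  (`S (R, t) = G R` on `e.far R₀`) and reaches only through radiation of fluence `O(R⁻²)`.
  PAPER VERDICT (docstring of §1): for `η` below the smallness constants
  `ε_o², μ_o` of Mao–Oh–Tao's Thm 1.7 and of the stability of Minkowski space the poison exists modulo
  the expected codimension-EXACTLY-one exceptional walls of vacuum collapse (Kehle–Unger
  arXiv:2402.10190, Conj. 3 and 5: extremal critical collapse, "any nearby interpolating family also
  intersects `𝔅_crit`"; or the critical-collapse threshold), swept across the radius; for `η > 64` every
  member is sheet-shielded (the isotropic throat `‖x‖ = m R / 2 > 32R` is a minimal sphere inside the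
  exact zone, the datum and the probe sit behind trapped spheres, the domain of outer communication is
  Kruskal region I whatever they do) and D″ degenerates into SwallowTheDatum's burial with the probe and
  the threshold idle.  Hence `FarAnnulusGluing ∧ D″` is false on paper: the growing schedule cannot
  carry a stable-unfolding core, and sharing 15427's gluing atom is not available to this line.
* §2 THE SAME SHAPE FOR D′ (`stableUnfoldingOneAtlas_false_of_poison`): D′ is false as soon as one
  admissible datum is poisoned for REMOTE SURGERY (over every probe some
  `IsRemoteSurgery` — shrinking schedule `m R → M₀` WITH the rescaled `H² × H¹` smallness `sobDev → 0`
  on every dyadic annulus beyond `R` — has unbounded exceptional radii at a fixed `t`).  PAPER VERDICT: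
  none is expected — the `sobDev` clause is subcritical (`s = 2 > 3/2`): a configuration of mass `μ`
  concentrated at scale `ρ₀` inside `A_λ`, `λ ≥ R`, costs `λ ∫ |∂² δh|² ≳ R μ² / ρ₀³`, which is
  `≳ R / μ → ∞` at collapse compactness `ρ₀ ≲ μ` and `≳ R μ / δ₀² → ∞` for a focusing pulse of width
  `δ₀ ≲ μ`; so neither a black-hole threshold nor an extremality wall fits inside a remote surgery.  D′
  survives exactly BECAUSE of the clause that D″ drops: `sobDev`-smallness is LOAD-BEARING for the
  stable-unfolding core.

References: Mao–Oh–Tao arXiv:2308.13031 (Def 1.5, Thm 1.7 with (1.17)–(1.22), Rem 1.8/1.9, Thm 1.10);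
Kehle–Unger arXiv:2402.10190 (Thm 1, Conj. 3, Conj. 5, Rem. 1.12); Chruściel–Corvino–Isenberg,
CMP 304 (2011) (N-body data); Christodoulou, *The formation of black holes in general relativity* (2009),
Thm 17.1; Klainerman–Nicolò, *The evolution problem in general relativity* (2003); Klainerman–Rodnianski–
Szeftel, Invent. Math. 202 (2015); Christodoulou, CQG 16 (1999) A23, p. A24; Dafermos–Luk
arXiv:1710.01722, Conjecture 1.
-/

-- the doubled `FinalStateConjecture` path component is the summit/problem naming scheme, not a mistake
set_option linter.dupNamespace false

noncomputable section

namespace Summit.FinalStateConjecture.FinalStateConjecture.Theorems.HonestFixedRadiusSettling.Negative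

open scoped Manifold ContDiff Topology
open Set Filter Function Literature.Geometry.Lorentzian
open Summit.FinalStateConjecture.FinalStateConjecture.Theorems.SwallowTheDatum.ParametricKerrBurial
  (SmoothSectionsOn AgreeAt IsExactSchwarzschildBeyond)
open Summit.FinalStateConjecture.FinalStateConjecture.Theorems.StarvedNecks.FarFieldSurgery
  (IsInteriorProbe IsRemoteSurgery stub_probePatch)

variable {X : Type} [TopologicalSpace X] [ChartedSpace E3 X] [IsManifold (𝓡 3) ∞ X] [ConnectedSpace X]

/-! ### §1 The kill shape of D″ (`stub_stableUnfoldingGrowing`): one poisoned growing family -/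

/-- **THE KILL SHAPE OF D″ — one POISONED growing far-gluing family.**  Hypotheses: a far-gluing family
`(η, e, R⋆, m, G)` of the admissible datum `d` in the growing schedule, exactly as D″ reads it (admissible
members equal to `d` off `e.far R`, `m R ≥ ηR`, exactly Schwarzschild(`m R`) beyond `32R`, `m` smooth, `G`
jointly smooth), which is POISONED (`hpoison`): for EVERY radius `R₀ ∈ (e.R, R⋆)` and EVERY radius-indexed
family `P` of admissible data agreeing with `G R` on `e.far R₀` (every way of re-filling the interiors
below `R₀`) the exceptional radii `{R > R⋆ | P R ∉ coreSet X}` are unbounded.  Conclusion: the registered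
stub `stub_stableUnfoldingGrowing` (D″; the negated proposition is its statement verbatim) is false —
D″'s probe `E` and the LANDED patching engine `stub_probePatch` (p116096) produce the patched surgery `S`,
D″'s threshold `ρ` puts `S (R, 1/2)` in `coreSet X` for every `R ≥ ρ (1/2)`, while the poison applied to
the re-filling `P R := S (R, 1/2)` yields an exceptional `R ≥ ρ (1/2)`.  So D″ claims, on top of the
final-state core, that NO admissible far-annulus content is robustly exceptional across radii.
INTENDED WITNESS of the hypotheses (paper, vacuum; not constructible in the tree, which builds no
development of a non-trivial datum): `η < min(ε_o², μ_o)` (Mao–Oh–Tao arXiv:2308.13031 Thm 1.7 at scale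
`R` glues the two-body datum below to Schwarzschild(`ηR + …`) with (1.17)–(1.21) satisfied, output
`√η`-flat in every rescaled `Hˢ`, hence dispersing by exterior stability of Minkowski space); below the
glue, at chart radius `≈ 8R`, a unit-size member `Ψ_{λ(R)}`, `λ(R) = λ_crit + sin R`, of a one-parameter
family crossing a codimension-one exceptional wall of the final-state property — extremal critical
collapse, Kehle–Unger arXiv:2402.10190 Conj. 5 (vacuum) with the robustness of Conj. 3 ("any nearby
interpolating family also intersects `𝔅_crit`"), or the critical-collapse threshold — placed by N-body
gluing (Chruściel–Corvino–Isenberg 2011) at separation `8R` from the untouched `d`.  A re-filling below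
`R₀` has quasi-local mass pinned near `M_ADM(d)` by its agreement with `d` on `e.far R₀ ∖ e.far R` and
perturbs the plant only by radiation of fluence `O(R⁻²)`, while the inward half of the glue shell washes over it
as a wave of length `≍ R` and amplitude `≍ √η` (tidal field `√η/R²`, absorption `O(R⁻ᵖ)`); so on every period
of `sin R` the perturbed family still crosses the wall, at a member whose domain of outer communication
contains a hole settling to an exactly extremal Kerr (no honest decomposition: `Kerr.IsSubextremal` in
`honestCoreSet` and fixed-radius `C⁴` convergence pin the parameters) or is naked (`𝓘⁺` incomplete,
excluded by CERT): `P R ∉ coreSet X` for unboundedly many `R`, whatever the interior.  MERGER GUARD: if the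
re-filled interior forms black holes, a head-on merger with the plant would defuse extremality in finite time
(`χ_f < 1` robustly); therefore the plant is given a slow ESCAPING boost `|v| = R^{-1/4} ≫ v_esc ≍ R^{-1/2}`,
balanced by an oppositely boosted small counterweight (admissible data have `P_ADM = 0`, `k = o(r⁻²)`), and
recedes forever — final state `N ≥ 2` with one exactly extremal, slowly boosted hole (boosted holes are
allowed by the decomposition, extremal ones are not).  For `η > 64` no poison exists (the isotropic throat
`‖x‖ = m R/2 > 32R` is a minimal sphere in the exact zone and shields everything below it) — there D″ is
SwallowTheDatum's burial with probe and threshold idle.  Under the first reduction's smallness clause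
(`IsRemoteSurgery`, `sobDev → 0`) the poison cannot occur either (§2). [cite: KehleUnger2024, Conjecture 3] -/
theorem stableUnfoldingGrowing_false_of_poison [T2Space X] [SecondCountableTopology X]
    {d : InitialDataSet (𝓡 3) X} (hd : d ∈ admissibleVacuumData X) {η : ℝ} {e : AFEnd X} {Rstar : ℝ}
    {m : ℝ → ℝ} {G : ℝ → InitialDataSet (𝓡 3) X} (hη : 0 < η) (hsole : e.IsSoleEnd) (heR : e.R < Rstar)
    (hm : ContDiff ℝ ∞ m) (hGsmooth : SmoothSectionsOn 𝓘(ℝ, ℝ) G {p : ℝ × X | Rstar < p.1})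
    (hGmem : ∀ R : ℝ, Rstar < R → G R ∈ admissibleVacuumData X ∧ (∀ x ∉ e.far R, AgreeAt (G R) d x) ∧
      η * R ≤ m R ∧ IsExactSchwarzschildBeyond e (G R) (m R) (32 * R))
    (hpoison : ∀ R₀ : ℝ, e.R < R₀ → R₀ < Rstar → ∀ P : ℝ → InitialDataSet (𝓡 3) X,
      (∀ R : ℝ, Rstar < R → P R ∈ admissibleVacuumData X ∧ ∀ x ∈ e.far R₀, AgreeAt (P R) (G R) x) →
        ∀ R₁ : ℝ, ∃ R : ℝ, R₁ ≤ R ∧ Rstar < R ∧ P R ∉ coreSet X) :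
    ¬ (∀ (X : Type) [TopologicalSpace X] [ChartedSpace E3 X] [IsManifold (𝓡 3) ∞ X] [T2Space X]
        [SecondCountableTopology X] [ConnectedSpace X], ∀ d ∈ admissibleVacuumData X,
        ∀ (η : ℝ) (e : AFEnd X) (Rstar : ℝ) (m : ℝ → ℝ) (G : ℝ → InitialDataSet (𝓡 3) X),
          0 < η → e.IsSoleEnd → e.R < Rstar → ContDiff ℝ ∞ m →
          SmoothSectionsOn 𝓘(ℝ, ℝ) G {p : ℝ × X | Rstar < p.1} →
          (∀ R : ℝ, Rstar < R → G R ∈ admissibleVacuumData X ∧ (∀ x ∉ e.far R, AgreeAt (G R) d x) ∧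
            η * R ≤ m R ∧ IsExactSchwarzschildBeyond e (G R) (m R) (32 * R)) →
          ∃ (R₀ : ℝ) (E : ℝ → InitialDataSet (𝓡 3) X) (x₀ : X) (v₀ : TangentSpace (𝓡 3) x₀),
            e.R < R₀ ∧ R₀ < Rstar ∧ SmoothSectionsOn 𝓘(ℝ, ℝ) E (Set.univ : Set (ℝ × X)) ∧ E 0 = d ∧
            (∀ t : ℝ, E t ∈ admissibleVacuumData X) ∧ (∀ t : ℝ, ∀ x ∈ e.far R₀, AgreeAt (E t) d x) ∧
            x₀ ∉ e.far R₀ ∧ Set.InjOn (fun t : ℝ ↦ (E t).h.inner x₀ v₀ v₀) (Set.Ioo (-1) 1) ∧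
            ∀ S : ℝ × ℝ → InitialDataSet (𝓡 3) X,
              SmoothSectionsOn (𝓘(ℝ, ℝ).prod 𝓘(ℝ, ℝ)) S {p : (ℝ × ℝ) × X | Rstar < p.1.1} →
              (∀ R t : ℝ, Rstar < R →
                S (R, t) ∈ admissibleVacuumData X ∧
                (∀ x ∉ e.far R, AgreeAt (S (R, t)) (E t) x) ∧
                (∀ x ∈ e.far R₀, AgreeAt (S (R, t)) (G R) x)) →
              ∃ ρ : ℝ → ℝ, ContinuousOn ρ {t : ℝ | t ≠ 0} ∧
                ∀ R t : ℝ, Rstar < R → ρ t ≤ R → t ≠ 0 → |t| < 1 → S (R, t) ∈ coreSet X) := by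
  intro hD
  obtain ⟨R₀, E, x₀, v₀, hR₀, hR₀star, hEsmooth, -, hEadm, hEd, -, -, hrob⟩ :=
    hD X d hd η e Rstar m G hη hsole heR hm hGsmooth hGmem
  obtain ⟨S, hSsmooth, hS⟩ := stub_probePatch X d e R₀ Rstar E G hsole hR₀ hR₀star hEsmooth hEadm hEd
    hGsmooth fun R hR ↦ ⟨(hGmem R hR).1, (hGmem R hR).2.1⟩
  obtain ⟨ρ, -, hgood⟩ := hrob S hSsmooth hS
  obtain ⟨R, hρR, hR, hbad⟩ := hpoison R₀ hR₀ hR₀star (fun R ↦ S (R, 1 / 2))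
    (fun R hR ↦ ⟨(hS R (1 / 2) hR).1, (hS R (1 / 2) hR).2.2⟩) (ρ (1 / 2))
  exact hbad (hgood R (1 / 2) hR hρR (by norm_num) (by rw [abs_of_pos (by norm_num)]; norm_num))

/-- **D″ restated as a CURE principle** (kernel-checked consequence of the registered stub, whose statement
is the first hypothesis verbatim): EVERY growing far-gluing family of EVERY admissible datum is cured beyond
some radius by ONE fixed admissible re-filling of the interior below some `R₀ < R⋆` — an admissible `D₁`
equal to `d` on `e.far R₀` (namely `E (1/2)`) and a radius-indexed family `P` of admissible data
(namely `S (·, 1/2)`) with `P R = D₁` off `e.far R` and `P R = G R` on `e.far R₀`, all of whose members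
beyond some `R₁` lie in `Negative.coreSet X`.  The far annuli of `G` being arbitrary admissible data of
mass `≥ ηR − M_ADM(d)` untouched by `D₁`, this is the statement refuted on paper in the docstring of
`stableUnfoldingGrowing_false_of_poison`. [cite: KehleUnger2024, Conjecture 3] -/
theorem cure_of_stableUnfoldingGrowing
    (hD : ∀ (X : Type) [TopologicalSpace X] [ChartedSpace E3 X] [IsManifold (𝓡 3) ∞ X] [T2Space X]
        [SecondCountableTopology X] [ConnectedSpace X], ∀ d ∈ admissibleVacuumData X,
        ∀ (η : ℝ) (e : AFEnd X) (Rstar : ℝ) (m : ℝ → ℝ) (G : ℝ → InitialDataSet (𝓡 3) X),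
          0 < η → e.IsSoleEnd → e.R < Rstar → ContDiff ℝ ∞ m →
          SmoothSectionsOn 𝓘(ℝ, ℝ) G {p : ℝ × X | Rstar < p.1} →
          (∀ R : ℝ, Rstar < R → G R ∈ admissibleVacuumData X ∧ (∀ x ∉ e.far R, AgreeAt (G R) d x) ∧
            η * R ≤ m R ∧ IsExactSchwarzschildBeyond e (G R) (m R) (32 * R)) →
          ∃ (R₀ : ℝ) (E : ℝ → InitialDataSet (𝓡 3) X) (x₀ : X) (v₀ : TangentSpace (𝓡 3) x₀),
            e.R < R₀ ∧ R₀ < Rstar ∧ SmoothSectionsOn 𝓘(ℝ, ℝ) E (Set.univ : Set (ℝ × X)) ∧ E 0 = d ∧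
            (∀ t : ℝ, E t ∈ admissibleVacuumData X) ∧ (∀ t : ℝ, ∀ x ∈ e.far R₀, AgreeAt (E t) d x) ∧
            x₀ ∉ e.far R₀ ∧ Set.InjOn (fun t : ℝ ↦ (E t).h.inner x₀ v₀ v₀) (Set.Ioo (-1) 1) ∧
            ∀ S : ℝ × ℝ → InitialDataSet (𝓡 3) X,
              SmoothSectionsOn (𝓘(ℝ, ℝ).prod 𝓘(ℝ, ℝ)) S {p : (ℝ × ℝ) × X | Rstar < p.1.1} →
              (∀ R t : ℝ, Rstar < R →
                S (R, t) ∈ admissibleVacuumData X ∧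
                (∀ x ∉ e.far R, AgreeAt (S (R, t)) (E t) x) ∧
                (∀ x ∈ e.far R₀, AgreeAt (S (R, t)) (G R) x)) →
              ∃ ρ : ℝ → ℝ, ContinuousOn ρ {t : ℝ | t ≠ 0} ∧
                ∀ R t : ℝ, Rstar < R → ρ t ≤ R → t ≠ 0 → |t| < 1 → S (R, t) ∈ coreSet X)
    [T2Space X] [SecondCountableTopology X] {d : InitialDataSet (𝓡 3) X} (hd : d ∈ admissibleVacuumData X)
    {η : ℝ} {e : AFEnd X} {Rstar : ℝ} {m : ℝ → ℝ} {G : ℝ → InitialDataSet (𝓡 3) X} (hη : 0 < η)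
    (hsole : e.IsSoleEnd) (heR : e.R < Rstar) (hm : ContDiff ℝ ∞ m)
    (hGsmooth : SmoothSectionsOn 𝓘(ℝ, ℝ) G {p : ℝ × X | Rstar < p.1})
    (hGmem : ∀ R : ℝ, Rstar < R → G R ∈ admissibleVacuumData X ∧ (∀ x ∉ e.far R, AgreeAt (G R) d x) ∧
      η * R ≤ m R ∧ IsExactSchwarzschildBeyond e (G R) (m R) (32 * R)) :
    ∃ (R₀ : ℝ) (D₁ : InitialDataSet (𝓡 3) X) (P : ℝ → InitialDataSet (𝓡 3) X) (R₁ : ℝ),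
      e.R < R₀ ∧ R₀ < Rstar ∧ D₁ ∈ admissibleVacuumData X ∧ (∀ x ∈ e.far R₀, AgreeAt D₁ d x) ∧
      (∀ R : ℝ, Rstar < R → P R ∈ admissibleVacuumData X ∧ (∀ x ∉ e.far R, AgreeAt (P R) D₁ x) ∧
        (∀ x ∈ e.far R₀, AgreeAt (P R) (G R) x)) ∧
      ∀ R : ℝ, R₁ ≤ R → Rstar < R → P R ∈ coreSet X := by
  obtain ⟨R₀, E, x₀, v₀, hR₀, hR₀star, hEsmooth, -, hEadm, hEd, -, -, hrob⟩ :=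
    hD X d hd η e Rstar m G hη hsole heR hm hGsmooth hGmem
  obtain ⟨S, hSsmooth, hS⟩ := stub_probePatch X d e R₀ Rstar E G hsole hR₀ hR₀star hEsmooth hEadm hEd
    hGsmooth fun R hR ↦ ⟨(hGmem R hR).1, (hGmem R hR).2.1⟩
  obtain ⟨ρ, -, hgood⟩ := hrob S hSsmooth hS
  refine ⟨R₀, E (1 / 2), fun R ↦ S (R, 1 / 2), ρ (1 / 2), hR₀, hR₀star, hEadm _, hEd _,
    fun R hR ↦ ⟨(hS R _ hR).1, (hS R _ hR).2.1, (hS R _ hR).2.2⟩, fun R hρR hR ↦ ?_⟩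
  exact hgood R (1 / 2) hR hρR (by norm_num) (by rw [abs_of_pos (by norm_num)]; norm_num)

/-! ### §2 The same kill shape for D′ (`stub_stableUnfoldingOneAtlas`) — and why it is expected EMPTY -/

/-- **THE KILL SHAPE OF D′ — one datum POISONED FOR REMOTE SURGERY.**  Hypothesis (`hpoison`): over
EVERY sole DR end, mass parameter, radius and interior probe through the admissible datum `d`, some remote
surgery (`IsRemoteSurgery`: shrinking schedule `m R → M₀` WITH `sobDev → 0` uniformly on all dyadic annuli
beyond `R`) has a fixed deformation parameter `0 < |t| < 1` whose exceptional radii are unbounded.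
Conclusion: the registered stub `stub_stableUnfoldingOneAtlas` (D′; the negated proposition is its
statement verbatim) is false — pure logic, D′'s threshold `ρ t` bounds the exceptional radii of every
remote surgery over its own probe.  Recorded to pin what a refutation of the first reduction's core must
produce.  PAPER VERDICT: NO such poison is expected — the rescaled `H² × H¹` smallness is subcritical
(`s = 2 > 3/2`): a lump of mass `μ` at scale `ρ₀` in `A_λ` (`λ ≥ R`) costs `λ ∫_{A_λ} |∂² δh|² ≳ R μ² / ρ₀³`,
i.e. `≳ R / μ → ∞` at collapse compactness `ρ₀ ≲ μ`, and a focusing pulse of width `δ₀` and energy `μ`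
costs `≳ R μ / δ₀²`, forcing `δ₀ ≫ √(R μ) ≫ μ` (no short pulse, Christodoulou 2009 Thm 17.1; no trapped
surface inside the Cauchy-stable window of the bounded-`L²`-curvature theorem); the far content of a
remote surgery therefore neither collapses nor reaches an extremality wall, and perturbs the interior's
settled sub-extremal holes only by absorbed energy `≤ m R − M₀ → 0` and angular momentum
`≲ (m R − M₀) Mᵢ → 0`, inside the threshold `ρ t`.  This is the precise sense in which the `sobDev` clause
of `IsRemoteSurgery` is LOAD-BEARING for D′: delete it (i.e. pass to the growing schedule of §1) and the
poison applies. [cite: MaoOhTao2023, Def 1.5] -/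
theorem stableUnfoldingOneAtlas_false_of_poison [T2Space X] [SecondCountableTopology X]
    {d : InitialDataSet (𝓡 3) X} (hd : d ∈ admissibleVacuumData X)
    (hpoison : ∀ (e : AFEnd X) (M₀ R₀ : ℝ) (E : ℝ → InitialDataSet (𝓡 3) X),
      e.IsSoleEnd → e.IsStronglyAsymptoticallyFlatDR d M₀ → IsInteriorProbe d e R₀ E →
        ∃ (Rstar : ℝ) (m : ℝ → ℝ) (S : ℝ × ℝ → InitialDataSet (𝓡 3) X),
          IsRemoteSurgery d e M₀ R₀ E Rstar m S ∧
            ∃ t : ℝ, t ≠ 0 ∧ |t| < 1 ∧ ∀ R₁ : ℝ, ∃ R : ℝ, R₁ ≤ R ∧ Rstar < R ∧ S (R, t) ∉ coreSet X) :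
    ¬ (∀ (X : Type) [TopologicalSpace X] [ChartedSpace E3 X] [IsManifold (𝓡 3) ∞ X] [T2Space X]
        [SecondCountableTopology X] [ConnectedSpace X], ∀ d ∈ admissibleVacuumData X,
        ∃ (e : AFEnd X) (M₀ R₀ : ℝ) (E : ℝ → InitialDataSet (𝓡 3) X) (x₀ : X)
          (v₀ : TangentSpace (𝓡 3) x₀),
          e.IsSoleEnd ∧ e.IsStronglyAsymptoticallyFlatDR d M₀ ∧ IsInteriorProbe d e R₀ E ∧
            x₀ ∉ e.far R₀ ∧ Set.InjOn (fun t : ℝ ↦ (E t).h.inner x₀ v₀ v₀) (Set.Ioo (-1) 1) ∧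
            ∀ (Rstar : ℝ) (m : ℝ → ℝ) (S : ℝ × ℝ → InitialDataSet (𝓡 3) X),
              IsRemoteSurgery d e M₀ R₀ E Rstar m S →
                ∃ ρ : ℝ → ℝ, ContinuousOn ρ {t : ℝ | t ≠ 0} ∧
                  ∀ R t : ℝ, Rstar < R → ρ t ≤ R → t ≠ 0 → |t| < 1 → S (R, t) ∈ coreSet X) := by
  intro hD
  obtain ⟨e, M₀, R₀, E, x₀, v₀, hsole, hSAF, hprobe, -, -, hrob⟩ := hD X d hd
  obtain ⟨Rstar, m, S, hS, t, ht, ht1, hbad⟩ := hpoison e M₀ R₀ E hsole hSAF hprobe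
  obtain ⟨ρ, -, hgood⟩ := hrob Rstar m S hS
  obtain ⟨R, hρR, hR, hRbad⟩ := hbad (ρ t)
  exact hRbad (hgood R t hR hρR ht ht1)

end Summit.FinalStateConjecture.FinalStateConjecture.Theorems.HonestFixedRadiusSettling.Negative

end
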